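import Literature.Geometry.Kaehler.SiegelTorusThetaDivisorEtaModularWeight
import Literature.NumberTheory.ModularForms.SiegelThetaTransformationKappa
import HarnessLib

/-!
# De Jong's Thm. 1.3 EXACTLY: on `ϑ = 0`, `η(ᵗ(γZ+δ)⁻¹v, M(Z)) = ζ^{n+1} det(γZ+δ)^{(n+5)/2} q(v)^{n+1} η(v,Z)`
# with `ζ = κ(M) e(πi k(M,c))`, `κ(M)⁸ = 1`, and `det(γZ+δ)^{1/2}` a chosen holomorphic root

[tag: lange-cav-complex-tori] [linked: HodgeConjecture (lit-hodgefound SKELETON §A2, row A2-227)]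

Layer `Literature/Geometry/Kaehler`, namespace `Literature.Geometry.Kaehler.ComplexTorus`; lane
`lit-hodgefound` (Track 2 foundations library), skeleton seat `lit-hodgefound-skel-2` (generation 45), plan
row A2-227. Theorems only; no definition, no named fact.

The tree's A2-215 (`SiegelTorusThetaDivisorEtaModularWeight`) proved the modular half of de Jong's
Thm. 1.3 SQUARED and in absolute value, because no square root of `det(γZ+δ)` had been chosen; A2-210
(`SiegelTorusThetaDivisorEtaModular`) had it with the unnamed constant `C(Z, M, c) ≠ 0` of the theta
transformation formula. Generation 45 supplies the root (A2-222 `SiegelUpperHalfSpaceDenomDetRoot`: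
holomorphic `s` on `𝔥_g` with `s² = det(γZ+δ)`) and `κ(M)` itself (A2-223
`SiegelThetaTransformationKappa`: `C(Z, M, c) = κ(M) s(Z) e(πi k(M, c))`, `|κ(M)| = 1`, `κ(M)⁸ = 1`,
Lange Thm. 3.3.9 as printed). This file combines them into the statement AS PRINTED.

Sources, VERBATIM. R. de Jong, *Theta functions on the theta divisor*, Rocky Mountain J. Math. 40 (2010)
[held `paper:arxiv-math_0611810`], Thm. 1.3 (chunk p0003): "The function `η = η(z,τ)` is a theta
function of order `n+1` and weight `(n+5)/2` on the theta divisor." §4, proof (chunk p0008): "we recall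
from equation (thetatransform) that `θ(ᵗ(cτ+d)⁻¹z, (aτ+b)(cτ+d)⁻¹) = ζ_γ det(cτ+d)^{1/2} q(z,γ,τ) θ(z,τ)`
for all `z` […] and all `γ = (a b; c d)` in `Γ_{1,2}`, where `q(z,γ,τ) = e^{πi ᵗz(cτ+d)⁻¹cz}` and where
`ζ_γ` is an 8-th root of unity. We claim that
`η(ᵗ(cτ+d)⁻¹z, (aτ+b)(cτ+d)⁻¹) = det(cτ+d)^{(n+5)/2} ζ_γ^{n+1} q(z,γ,τ)^{n+1} η(z,τ)` for all `(z,τ)`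
satisfying `θ(z,τ) = 0`. This is just a calculation." (chunk p0003, (thetatransform): "for some 8-th
root of unity `ζ_γ` (cf. [mum], p. 189)".) H. Lange, *Abelian Varieties over the Complex Numbers* (2023),
§3.3.3 Thm. 3.3.9 (p0175): "`ϑ[M[c]](ᵗ(γZ+δ)⁻¹v, M(Z)) = κ(M) det(γZ+δ)^{1/2} e(πi k(M,c¹,c²))
e(πi ᵗv(γZ+δ)⁻¹γv) ϑ[c](v,Z)` […] `κ(M) ∈ ℂ₁` a constant with the same sign ambiguity as `det(γZ+δ)^{1/2}`".

Dictionary (as in A2-210/A2-215). `F′ = ϑ[M[a;b]](·, M(Z))`, `F = ϑ[a;b](·, Z)`, `D = denom(M,Z) = γZ+δ`,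
`q(v) = e(πi ᵗv D⁻¹γ v)` (`cexp (π I (v ⬝ᵥ (D⁻¹ γ) v))`, `γ = (M.map ↑).toBlocks₂₁`), `B_F(v)` the
bordered Hessian `(∂ᵢ∂ⱼF | ∂ᵢF ; ∂ⱼF | 0)` in the standard coordinates, `η = det B_F`; `s` = a continuous
root of `det D` on `𝔥_g` (exists, holomorphic: A2-222), `κ = κ(M)` relative to `s`, `k(M,c) =
thetaTransformPhase M a b`.

## Contents

* §1 **`exists_kappa_det_borderedHessian_riemannThetaChar_moeb_mulVec_eq`** — every `M ∈ Sp_{2g}(ℤ)`,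
  every characteristic: ONE `κ` (`|κ| = 1`, `κ⁸ = 1`) with the theta law `ϑ[M[c]](ᵗD⁻¹v, M(Z)) =
  κ s(Z) e(πik) q(v) ϑ[c](v,Z)` AND, on `ϑ[c](v,Z) = 0`,
  `η′(ᵗD⁻¹v) = (κ e(πi k(M,c)))^{n+1} · s(Z)^{n+5} · q(v)^{n+1} · η(v)` (`det(D)² = s⁴` absorbed: the
  weight `(n+5)/2` literally).
* §2 **`exists_kappa_det_borderedHessian_riemannThetaChar_zero_moeb_mulVec_eq`** — `c = 0`, every `M`:
  `η′ = κ^{n+1} s^{n+5} q^{n+1} η` on `ϑ(v,Z) = 0` (left side with `ϑ[M[0]]`).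
* §3 **`exists_kappa_det_borderedHessian_riemannTheta_moeb_mulVec_eq`** — `M ∈ Γ_{1,2}` (the tree's
  `thetaModularGroup`): Riemann's `ϑ` on both sides — de Jong's Thm. 1.3, modular half, VERBATIM:
  `θ(ᵗD⁻¹z, M(τ)) = ζ s(τ) q θ(z,τ)` and `η(ᵗD⁻¹z, M(τ)) = s(τ)^{n+5} ζ^{n+1} q^{n+1} η(z,τ)` on
  `θ(z,τ) = 0`, `ζ⁸ = 1`.
* §4 **`exists_root_kappa_det_borderedHessian_riemannTheta_moeb_mulVec_eq`** — the same with the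
  holomorphic root supplied (no hypotheses on `s`).

## References

* [DeJong2010ThetaFunctionsThetaDivisor] R. de Jong, Theta functions on the theta divisor, Rocky Mountain
  J. Math. 40 (2010), Thm. 1.3, §4 (proof).
* [Lange2023AbelianVarietiesComplex] H. Lange, Abelian Varieties over the Complex Numbers (2023), §3.3.3
  Thm. 3.3.9 (p0175; proof Step II p0177).
* [MumfordTata1] D. Mumford, Tata Lectures on Theta I (1983), Ch. II §5 (p. 189).
-/

noncomputable section

open scoped Matrix Topology Real
open Set Function Module Complex Matrix
open Literature.Analysis.SpecialFunctions Literature.Analysis.Complex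

namespace Literature.Geometry.Kaehler

namespace ComplexTorus

open Literature.NumberTheory.Automorphic (siegelUpperHalfSpace)
open Literature.NumberTheory.ModularForms.SiegelUpperHalfSpace (moeb denom)
open Literature.NumberTheory.ModularForms (thetaModularGroup mem_thetaModularGroup_iff_thetaChar_zero
  exists_kappa_riemannThetaChar_transform)

section EtaExact

variable {n : ℕ} {M : Matrix (Fin n ⊕ Fin n) (Fin n ⊕ Fin n) ℤ}

/-! ### §1 Every characteristic: `η′ = (κ e(πik))^{n+1} s^{n+5} q^{n+1} η` -/

/-- **DE JONG'S THM. 1.3, MODULAR HALF, EXACT (every `M ∈ Sp_{2g}(ℤ)`, every characteristic)**: for a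
continuous square root `s` of `Z ↦ det(γZ+δ)` on `𝔥_g` there is `κ = κ(M)` with `|κ| = 1`, `κ⁸ = 1`,
such that for all `Z ∈ 𝔥_g`, all `c = (a,b)` and all `v`:
`ϑ[M[c]](ᵗD⁻¹v, M(Z)) = κ s(Z) e(πi k(M,c)) q(v) ϑ[c](v,Z)`, and whenever `ϑ[c](v,Z) = 0`,
`η′(ᵗD⁻¹v) = (κ e(πi k(M,c)))^{n+1} · s(Z)^{n+5} · q(v)^{n+1} · η(v)` —
"`det(cτ+d)^{(n+5)/2} ζ_γ^{n+1} q(z,γ,τ)^{n+1} η(z,τ)`" with `ζ = κ(M) e(πi k(M,c))`.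
[cite: DeJong2010ThetaFunctionsThetaDivisor, Thm. 1.3 and §4, proof (chunk p0008: "This is just a calculation")] [cite: Lange2023AbelianVarietiesComplex, §3.3.3 Thm. 3.3.9 (p0175: "`κ(M) det(γZ+δ)^{1/2} e(πi k(M,c¹,c²))`")] -/
theorem exists_kappa_det_borderedHessian_riemannThetaChar_moeb_mulVec_eq
    (hM : M ∈ Matrix.symplecticGroup (Fin n) ℤ)
    {s : Matrix (Fin n) (Fin n) ℂ → ℂ} (hs : ContinuousOn s (siegelUpperHalfSpace n))
    (hs2 : ∀ Z ∈ siegelUpperHalfSpace n, s Z ^ 2 = (denom (M.map ((↑) : ℤ → ℂ)) Z).det) :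
    ∃ κ : ℂ, ‖κ‖ = 1 ∧ κ ^ 8 = 1 ∧
      (∀ Z ∈ siegelUpperHalfSpace n, ∀ (a b v : Fin n → ℂ),
        riemannThetaChar (thetaCharFst M a b) (thetaCharSnd M a b) (moeb (M.map ((↑) : ℤ → ℂ)) Z)
            ((denom (M.map ((↑) : ℤ → ℂ)) Z)ᵀ⁻¹ *ᵥ v) =
          κ * s Z * cexp (π * I * thetaTransformPhase M a b) *
            cexp (π * I * (v ⬝ᵥ ((denom (M.map ((↑) : ℤ → ℂ)) Z)⁻¹ *
              (M.map ((↑) : ℤ → ℂ)).toBlocks₂₁) *ᵥ v)) * riemannThetaChar a b Z v) ∧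
      ∀ Z ∈ siegelUpperHalfSpace n, ∀ (a b v : Fin n → ℂ), riemannThetaChar a b Z v = 0 →
        (Matrix.fromBlocks
            (Matrix.of fun i j : Fin n => fderiv ℂ (fderiv ℂ (riemannThetaChar (thetaCharFst M a b)
              (thetaCharSnd M a b) (moeb (M.map ((↑) : ℤ → ℂ)) Z)))
              ((denom (M.map ((↑) : ℤ → ℂ)) Z)ᵀ⁻¹ *ᵥ v) (Pi.single i (1 : ℂ)) (Pi.single j (1 : ℂ)))
            (Matrix.of fun (i : Fin n) (_ : Unit) => fderiv ℂ (riemannThetaChar (thetaCharFst M a b)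
              (thetaCharSnd M a b) (moeb (M.map ((↑) : ℤ → ℂ)) Z))
              ((denom (M.map ((↑) : ℤ → ℂ)) Z)ᵀ⁻¹ *ᵥ v) (Pi.single i (1 : ℂ)))
            (Matrix.of fun (_ : Unit) (j : Fin n) => fderiv ℂ (riemannThetaChar (thetaCharFst M a b)
              (thetaCharSnd M a b) (moeb (M.map ((↑) : ℤ → ℂ)) Z))
              ((denom (M.map ((↑) : ℤ → ℂ)) Z)ᵀ⁻¹ *ᵥ v) (Pi.single j (1 : ℂ)))
            (0 : Matrix Unit Unit ℂ)).det =
          (κ * cexp (π * I * thetaTransformPhase M a b)) ^ (n + 1) * s Z ^ (n + 5) *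
            cexp (π * I * (v ⬝ᵥ ((denom (M.map ((↑) : ℤ → ℂ)) Z)⁻¹ *
              (M.map ((↑) : ℤ → ℂ)).toBlocks₂₁) *ᵥ v)) ^ (n + 1) *
            (Matrix.fromBlocks
              (Matrix.of fun i j : Fin n => fderiv ℂ (fderiv ℂ (riemannThetaChar a b Z)) v
                (Pi.single i (1 : ℂ)) (Pi.single j (1 : ℂ)))
              (Matrix.of fun (i : Fin n) (_ : Unit) => fderiv ℂ (riemannThetaChar a b Z) v (Pi.single i (1 : ℂ)))
              (Matrix.of fun (_ : Unit) (j : Fin n) => fderiv ℂ (riemannThetaChar a b Z) v (Pi.single j (1 : ℂ)))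
              (0 : Matrix Unit Unit ℂ)).det := by
  obtain ⟨κ, hκn, hκ8, hlaw, huniq⟩ := exists_kappa_riemannThetaChar_transform hM hs hs2
  refine ⟨κ, hκn, hκ8, hlaw, fun Z hZ a b v hv => ?_⟩
  obtain ⟨C, -, hCF, hdet⟩ := exists_riemannThetaChar_transform_and_det_borderedHessian_eq hM hZ a b
  have hC : C = κ * s Z * cexp (π * I * thetaTransformPhase M a b) := huniq Z hZ a b C hCF
  rw [hdet v hv, hC, ← hs2 Z hZ]
  generalize (Matrix.fromBlocks
      (Matrix.of fun i j : Fin n => fderiv ℂ (fderiv ℂ (riemannThetaChar a b Z)) v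
        (Pi.single i (1 : ℂ)) (Pi.single j (1 : ℂ)))
      (Matrix.of fun (i : Fin n) (_ : Unit) => fderiv ℂ (riemannThetaChar a b Z) v (Pi.single i (1 : ℂ)))
      (Matrix.of fun (_ : Unit) (j : Fin n) => fderiv ℂ (riemannThetaChar a b Z) v (Pi.single j (1 : ℂ)))
      (0 : Matrix Unit Unit ℂ)).det = η
  generalize cexp (π * I * (v ⬝ᵥ ((denom (M.map ((↑) : ℤ → ℂ)) Z)⁻¹ *
    (M.map ((↑) : ℤ → ℂ)).toBlocks₂₁) *ᵥ v)) = q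
  ring

/-! ### §2 The characteristic `c = 0`: `η′ = κ^{n+1} s^{n+5} q^{n+1} η` on `ϑ(v,Z) = 0` -/

/-- `ϑ[0;0](·, Z) = ϑ(·, Z)` as functions. [cite: MumfordTata1, Ch. II §1] -/
private theorem riemannThetaChar_zero_zero_eq (Z : Matrix (Fin n) (Fin n) ℂ) :
    riemannThetaChar 0 0 Z = riemannTheta Z :=
  funext fun v => riemannThetaChar_zero_zero Z v

/-- **`c = 0`, every `M ∈ Sp_{2g}(ℤ)`**: with `κ = κ(M)` (`|κ| = 1`, `κ⁸ = 1`) and the root `s`,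
`ϑ[M[0]](ᵗD⁻¹v, M(Z)) = κ s(Z) q(v) ϑ(v,Z)` for all `v`, and on `ϑ(v,Z) = 0`:
`η′(ᵗD⁻¹v) = κ^{n+1} · s(Z)^{n+5} · q(v)^{n+1} · η(v)` (here `η′` is the bordered Hessian determinant of
`ϑ[M[0]](·, M(Z))`, `η` that of `ϑ(·, Z)`).
[cite: DeJong2010ThetaFunctionsThetaDivisor, Thm. 1.3 and §4, proof (chunk p0008)] [cite: Lange2023AbelianVarietiesComplex, §3.3.3 Thm. 3.3.9 (p0175)] -/
theorem exists_kappa_det_borderedHessian_riemannThetaChar_zero_moeb_mulVec_eq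
    (hM : M ∈ Matrix.symplecticGroup (Fin n) ℤ)
    {s : Matrix (Fin n) (Fin n) ℂ → ℂ} (hs : ContinuousOn s (siegelUpperHalfSpace n))
    (hs2 : ∀ Z ∈ siegelUpperHalfSpace n, s Z ^ 2 = (denom (M.map ((↑) : ℤ → ℂ)) Z).det) :
    ∃ κ : ℂ, ‖κ‖ = 1 ∧ κ ^ 8 = 1 ∧
      (∀ Z ∈ siegelUpperHalfSpace n, ∀ v : Fin n → ℂ,
        riemannThetaChar (thetaCharFst M 0 0) (thetaCharSnd M 0 0) (moeb (M.map ((↑) : ℤ → ℂ)) Z)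
            ((denom (M.map ((↑) : ℤ → ℂ)) Z)ᵀ⁻¹ *ᵥ v) =
          κ * s Z * cexp (π * I * (v ⬝ᵥ ((denom (M.map ((↑) : ℤ → ℂ)) Z)⁻¹ *
              (M.map ((↑) : ℤ → ℂ)).toBlocks₂₁) *ᵥ v)) * riemannTheta Z v) ∧
      ∀ Z ∈ siegelUpperHalfSpace n, ∀ v : Fin n → ℂ, riemannTheta Z v = 0 →
        (Matrix.fromBlocks
            (Matrix.of fun i j : Fin n => fderiv ℂ (fderiv ℂ (riemannThetaChar (thetaCharFst M 0 0)
              (thetaCharSnd M 0 0) (moeb (M.map ((↑) : ℤ → ℂ)) Z)))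
              ((denom (M.map ((↑) : ℤ → ℂ)) Z)ᵀ⁻¹ *ᵥ v) (Pi.single i (1 : ℂ)) (Pi.single j (1 : ℂ)))
            (Matrix.of fun (i : Fin n) (_ : Unit) => fderiv ℂ (riemannThetaChar (thetaCharFst M 0 0)
              (thetaCharSnd M 0 0) (moeb (M.map ((↑) : ℤ → ℂ)) Z))
              ((denom (M.map ((↑) : ℤ → ℂ)) Z)ᵀ⁻¹ *ᵥ v) (Pi.single i (1 : ℂ)))
            (Matrix.of fun (_ : Unit) (j : Fin n) => fderiv ℂ (riemannThetaChar (thetaCharFst M 0 0)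
              (thetaCharSnd M 0 0) (moeb (M.map ((↑) : ℤ → ℂ)) Z))
              ((denom (M.map ((↑) : ℤ → ℂ)) Z)ᵀ⁻¹ *ᵥ v) (Pi.single j (1 : ℂ)))
            (0 : Matrix Unit Unit ℂ)).det =
          κ ^ (n + 1) * s Z ^ (n + 5) *
            cexp (π * I * (v ⬝ᵥ ((denom (M.map ((↑) : ℤ → ℂ)) Z)⁻¹ *
              (M.map ((↑) : ℤ → ℂ)).toBlocks₂₁) *ᵥ v)) ^ (n + 1) *
            (Matrix.fromBlocks
              (Matrix.of fun i j : Fin n => fderiv ℂ (fderiv ℂ (riemannTheta Z)) v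
                (Pi.single i (1 : ℂ)) (Pi.single j (1 : ℂ)))
              (Matrix.of fun (i : Fin n) (_ : Unit) => fderiv ℂ (riemannTheta Z) v (Pi.single i (1 : ℂ)))
              (Matrix.of fun (_ : Unit) (j : Fin n) => fderiv ℂ (riemannTheta Z) v (Pi.single j (1 : ℂ)))
              (0 : Matrix Unit Unit ℂ)).det := by
  obtain ⟨κ, hκn, hκ8, hlaw, hdet⟩ := exists_kappa_det_borderedHessian_riemannThetaChar_moeb_mulVec_eq hM hs hs2
  refine ⟨κ, hκn, hκ8, fun Z hZ v => ?_, fun Z hZ v hv => ?_⟩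
  · rw [hlaw Z hZ 0 0 v, thetaTransformPhase_zero_zero, mul_zero, Complex.exp_zero, mul_one,
      riemannThetaChar_zero_zero]
  · have hv' : riemannThetaChar 0 0 Z v = 0 := by rw [riemannThetaChar_zero_zero]; exact hv
    have h := hdet Z hZ 0 0 v hv'
    rw [thetaTransformPhase_zero_zero, mul_zero, Complex.exp_zero, mul_one, riemannThetaChar_zero_zero_eq] at h
    exact h

/-! ### §3 `M ∈ Γ_{1,2}`: Riemann's `ϑ` on both sides (de Jong's Thm. 1.3 verbatim) -/

/-- For `M ∈ Γ_{1,2}` the transformed characteristic `M[0]` is integral, so `ϑ[M[0]](·, W) = ϑ(·, W)`.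
[cite: Lange2023AbelianVarietiesComplex, §3.5.1 Lemma 3.5.1 (p0186)] [cite: MumfordTata1, Ch. II §5] -/
private theorem riemannThetaChar_thetaChar_zero_eq_riemannTheta {M : Matrix.symplecticGroup (Fin n) ℤ}
    (hM : M ∈ thetaModularGroup n) (W : Matrix (Fin n) (Fin n) ℂ) :
    riemannThetaChar (thetaCharFst (M : Matrix (Fin n ⊕ Fin n) (Fin n ⊕ Fin n) ℤ) 0 0)
      (thetaCharSnd (M : Matrix (Fin n ⊕ Fin n) (Fin n ⊕ Fin n) ℤ) 0 0) W = riemannTheta W := by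
  obtain ⟨n₁, n₂, h₁, h₂⟩ := (mem_thetaModularGroup_iff_thetaChar_zero M).1 hM
  funext v
  rw [h₁, h₂, show (fun i ↦ (n₁ i : ℂ)) = 0 + fun i ↦ (n₁ i : ℂ) from (zero_add _).symm,
    show (fun i ↦ (n₂ i : ℂ)) = 0 + fun i ↦ (n₂ i : ℂ) from (zero_add _).symm,
    riemannThetaChar_charShift, zero_dotProduct, mul_zero, Complex.exp_zero, one_mul,
    riemannThetaChar_zero_zero]

/-- **DE JONG'S THM. 1.3 (modular half), AS PRINTED**: let `M = (a b; c d) ∈ Γ_{1,2}` and let `s` be a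
continuous square root of `τ ↦ det(cτ+d)` on `𝔥_n`. There is an 8-th root of unity `ζ = ζ_γ` (`|ζ| = 1`,
`ζ⁸ = 1`) with `θ(ᵗ(cτ+d)⁻¹z, (aτ+b)(cτ+d)⁻¹) = ζ det(cτ+d)^{1/2} q(z,γ,τ) θ(z,τ)` for all `z`, `τ`, and
`η(ᵗ(cτ+d)⁻¹z, (aτ+b)(cτ+d)⁻¹) = det(cτ+d)^{(n+5)/2} ζ^{n+1} q(z,γ,τ)^{n+1} η(z,τ)` for all `(z,τ)` with
`θ(z,τ) = 0` — where `det(cτ+d)^{1/2} := s(τ)`, `det(cτ+d)^{(n+5)/2} := s(τ)^{n+5}`,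
`q(z,γ,τ) = e^{πi ᵗz(cτ+d)⁻¹cz}`, and `η = det (θᵢⱼ | θᵢ ; θⱼ | 0)`.
[cite: DeJong2010ThetaFunctionsThetaDivisor, Thm. 1.3 (chunk p0003: "weight `(n+5)/2` on the theta divisor") and §4, proof (chunk p0008)] [cite: MumfordTata1, Ch. II §5 (p. 189: `ζ_γ⁸ = 1`)] [cite: Lange2023AbelianVarietiesComplex, §3.3.3 Thm. 3.3.9 (p0175)] -/
theorem exists_kappa_det_borderedHessian_riemannTheta_moeb_mulVec_eq {M : Matrix.symplecticGroup (Fin n) ℤ}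
    (hM : M ∈ thetaModularGroup n) {s : Matrix (Fin n) (Fin n) ℂ → ℂ}
    (hs : ContinuousOn s (siegelUpperHalfSpace n))
    (hs2 : ∀ Z ∈ siegelUpperHalfSpace n, s Z ^ 2 =
      (denom ((M : Matrix (Fin n ⊕ Fin n) (Fin n ⊕ Fin n) ℤ).map ((↑) : ℤ → ℂ)) Z).det) :
    ∃ ζ : ℂ, ‖ζ‖ = 1 ∧ ζ ^ 8 = 1 ∧
      (∀ Z ∈ siegelUpperHalfSpace n, ∀ v : Fin n → ℂ,
        riemannTheta (moeb ((M : Matrix (Fin n ⊕ Fin n) (Fin n ⊕ Fin n) ℤ).map ((↑) : ℤ → ℂ)) Z)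
            ((denom ((M : Matrix (Fin n ⊕ Fin n) (Fin n ⊕ Fin n) ℤ).map ((↑) : ℤ → ℂ)) Z)ᵀ⁻¹ *ᵥ v) =
          ζ * s Z * cexp (π * I * (v ⬝ᵥ ((denom ((M : Matrix (Fin n ⊕ Fin n) (Fin n ⊕ Fin n) ℤ).map
                ((↑) : ℤ → ℂ)) Z)⁻¹ *
              ((M : Matrix (Fin n ⊕ Fin n) (Fin n ⊕ Fin n) ℤ).map ((↑) : ℤ → ℂ)).toBlocks₂₁) *ᵥ v)) *
            riemannTheta Z v) ∧
      ∀ Z ∈ siegelUpperHalfSpace n, ∀ v : Fin n → ℂ, riemannTheta Z v = 0 →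
        (Matrix.fromBlocks
            (Matrix.of fun i j : Fin n => fderiv ℂ (fderiv ℂ (riemannTheta
              (moeb ((M : Matrix (Fin n ⊕ Fin n) (Fin n ⊕ Fin n) ℤ).map ((↑) : ℤ → ℂ)) Z)))
              ((denom ((M : Matrix (Fin n ⊕ Fin n) (Fin n ⊕ Fin n) ℤ).map ((↑) : ℤ → ℂ)) Z)ᵀ⁻¹ *ᵥ v)
              (Pi.single i (1 : ℂ)) (Pi.single j (1 : ℂ)))
            (Matrix.of fun (i : Fin n) (_ : Unit) => fderiv ℂ (riemannTheta
              (moeb ((M : Matrix (Fin n ⊕ Fin n) (Fin n ⊕ Fin n) ℤ).map ((↑) : ℤ → ℂ)) Z))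
              ((denom ((M : Matrix (Fin n ⊕ Fin n) (Fin n ⊕ Fin n) ℤ).map ((↑) : ℤ → ℂ)) Z)ᵀ⁻¹ *ᵥ v)
              (Pi.single i (1 : ℂ)))
            (Matrix.of fun (_ : Unit) (j : Fin n) => fderiv ℂ (riemannTheta
              (moeb ((M : Matrix (Fin n ⊕ Fin n) (Fin n ⊕ Fin n) ℤ).map ((↑) : ℤ → ℂ)) Z))
              ((denom ((M : Matrix (Fin n ⊕ Fin n) (Fin n ⊕ Fin n) ℤ).map ((↑) : ℤ → ℂ)) Z)ᵀ⁻¹ *ᵥ v)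
              (Pi.single j (1 : ℂ)))
            (0 : Matrix Unit Unit ℂ)).det =
          s Z ^ (n + 5) * ζ ^ (n + 1) *
            cexp (π * I * (v ⬝ᵥ ((denom ((M : Matrix (Fin n ⊕ Fin n) (Fin n ⊕ Fin n) ℤ).map
                ((↑) : ℤ → ℂ)) Z)⁻¹ *
              ((M : Matrix (Fin n ⊕ Fin n) (Fin n ⊕ Fin n) ℤ).map ((↑) : ℤ → ℂ)).toBlocks₂₁) *ᵥ v)) ^ (n + 1) *
            (Matrix.fromBlocks
              (Matrix.of fun i j : Fin n => fderiv ℂ (fderiv ℂ (riemannTheta Z)) v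
                (Pi.single i (1 : ℂ)) (Pi.single j (1 : ℂ)))
              (Matrix.of fun (i : Fin n) (_ : Unit) => fderiv ℂ (riemannTheta Z) v (Pi.single i (1 : ℂ)))
              (Matrix.of fun (_ : Unit) (j : Fin n) => fderiv ℂ (riemannTheta Z) v (Pi.single j (1 : ℂ)))
              (0 : Matrix Unit Unit ℂ)).det := by
  obtain ⟨κ, hκn, hκ8, hlaw, hdet⟩ :=
    exists_kappa_det_borderedHessian_riemannThetaChar_zero_moeb_mulVec_eq M.2 hs hs2
  refine ⟨κ, hκn, hκ8, fun Z hZ v => ?_, fun Z hZ v hv => ?_⟩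
  · have h := hlaw Z hZ v
    rw [riemannThetaChar_thetaChar_zero_eq_riemannTheta hM] at h
    exact h
  · have h := hdet Z hZ v hv
    rw [riemannThetaChar_thetaChar_zero_eq_riemannTheta hM] at h
    rw [h]
    ring

/-! ### §4 The same with the holomorphic root supplied -/

/-- **De Jong's Thm. 1.3 (modular half) with the root supplied**: for `M ∈ Γ_{1,2}` there are a
holomorphic square root `s` of `τ ↦ det(cτ+d)` on `𝔥_n` (A2-222) and an 8-th root of unity `ζ` such
that `θ(ᵗ(cτ+d)⁻¹z, M(τ)) = ζ s(τ) q θ(z,τ)` and, on `θ(z,τ) = 0`,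
`η(ᵗ(cτ+d)⁻¹z, M(τ)) = s(τ)^{n+5} ζ^{n+1} q^{n+1} η(z,τ)`.
[cite: DeJong2010ThetaFunctionsThetaDivisor, Thm. 1.3 and §4, proof (chunk p0008)] [cite: Lange2023AbelianVarietiesComplex, §3.3.3 Thm. 3.3.9, proof Step II (p0177: "`det(γZ+δ)^{1/2}`, which is an analytic function")] -/
theorem exists_root_kappa_det_borderedHessian_riemannTheta_moeb_mulVec_eq
    {M : Matrix.symplecticGroup (Fin n) ℤ} (hM : M ∈ thetaModularGroup n) :
    ∃ s : Matrix (Fin n) (Fin n) ℂ → ℂ, (∀ Z ∈ siegelUpperHalfSpace n, DifferentiableAt ℂ s Z) ∧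
      (∀ Z ∈ siegelUpperHalfSpace n, s Z ^ 2 =
        (denom ((M : Matrix (Fin n ⊕ Fin n) (Fin n ⊕ Fin n) ℤ).map ((↑) : ℤ → ℂ)) Z).det) ∧
    ∃ ζ : ℂ, ‖ζ‖ = 1 ∧ ζ ^ 8 = 1 ∧
      (∀ Z ∈ siegelUpperHalfSpace n, ∀ v : Fin n → ℂ,
        riemannTheta (moeb ((M : Matrix (Fin n ⊕ Fin n) (Fin n ⊕ Fin n) ℤ).map ((↑) : ℤ → ℂ)) Z)
            ((denom ((M : Matrix (Fin n ⊕ Fin n) (Fin n ⊕ Fin n) ℤ).map ((↑) : ℤ → ℂ)) Z)ᵀ⁻¹ *ᵥ v) =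
          ζ * s Z * cexp (π * I * (v ⬝ᵥ ((denom ((M : Matrix (Fin n ⊕ Fin n) (Fin n ⊕ Fin n) ℤ).map
                ((↑) : ℤ → ℂ)) Z)⁻¹ *
              ((M : Matrix (Fin n ⊕ Fin n) (Fin n ⊕ Fin n) ℤ).map ((↑) : ℤ → ℂ)).toBlocks₂₁) *ᵥ v)) *
            riemannTheta Z v) ∧
      ∀ Z ∈ siegelUpperHalfSpace n, ∀ v : Fin n → ℂ, riemannTheta Z v = 0 →
        (Matrix.fromBlocks
            (Matrix.of fun i j : Fin n => fderiv ℂ (fderiv ℂ (riemannTheta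
              (moeb ((M : Matrix (Fin n ⊕ Fin n) (Fin n ⊕ Fin n) ℤ).map ((↑) : ℤ → ℂ)) Z)))
              ((denom ((M : Matrix (Fin n ⊕ Fin n) (Fin n ⊕ Fin n) ℤ).map ((↑) : ℤ → ℂ)) Z)ᵀ⁻¹ *ᵥ v)
              (Pi.single i (1 : ℂ)) (Pi.single j (1 : ℂ)))
            (Matrix.of fun (i : Fin n) (_ : Unit) => fderiv ℂ (riemannTheta
              (moeb ((M : Matrix (Fin n ⊕ Fin n) (Fin n ⊕ Fin n) ℤ).map ((↑) : ℤ → ℂ)) Z))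
              ((denom ((M : Matrix (Fin n ⊕ Fin n) (Fin n ⊕ Fin n) ℤ).map ((↑) : ℤ → ℂ)) Z)ᵀ⁻¹ *ᵥ v)
              (Pi.single i (1 : ℂ)))
            (Matrix.of fun (_ : Unit) (j : Fin n) => fderiv ℂ (riemannTheta
              (moeb ((M : Matrix (Fin n ⊕ Fin n) (Fin n ⊕ Fin n) ℤ).map ((↑) : ℤ → ℂ)) Z))
              ((denom ((M : Matrix (Fin n ⊕ Fin n) (Fin n ⊕ Fin n) ℤ).map ((↑) : ℤ → ℂ)) Z)ᵀ⁻¹ *ᵥ v)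
              (Pi.single j (1 : ℂ)))
            (0 : Matrix Unit Unit ℂ)).det =
          s Z ^ (n + 5) * ζ ^ (n + 1) *
            cexp (π * I * (v ⬝ᵥ ((denom ((M : Matrix (Fin n ⊕ Fin n) (Fin n ⊕ Fin n) ℤ).map
                ((↑) : ℤ → ℂ)) Z)⁻¹ *
              ((M : Matrix (Fin n ⊕ Fin n) (Fin n ⊕ Fin n) ℤ).map ((↑) : ℤ → ℂ)).toBlocks₂₁) *ᵥ v)) ^ (n + 1) *
            (Matrix.fromBlocks
              (Matrix.of fun i j : Fin n => fderiv ℂ (fderiv ℂ (riemannTheta Z)) v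
                (Pi.single i (1 : ℂ)) (Pi.single j (1 : ℂ)))
              (Matrix.of fun (i : Fin n) (_ : Unit) => fderiv ℂ (riemannTheta Z) v (Pi.single i (1 : ℂ)))
              (Matrix.of fun (_ : Unit) (j : Fin n) => fderiv ℂ (riemannTheta Z) v (Pi.single j (1 : ℂ)))
              (0 : Matrix Unit Unit ℂ)).det := by
  obtain ⟨s, hsd, hs2⟩ :=
    Literature.NumberTheory.ModularForms.SiegelUpperHalfSpace.exists_sqrt_det_denom_intCast M.2
  have hs : ContinuousOn s (siegelUpperHalfSpace n) := fun Z hZ => (hsd Z hZ).continuousAt.continuousWithinAt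
  exact ⟨s, hsd, hs2, exists_kappa_det_borderedHessian_riemannTheta_moeb_mulVec_eq hM hs hs2⟩

end EtaExact

end ComplexTorus

end Literature.Geometry.Kaehler
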